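import Summits.KontsevichZagierPeriods.Zeta5Search.WedgeDictionaryCrossContiguity
import Summits.KontsevichZagierPeriods.Zeta5Search.WedgeDictionaryLevelDescentWeightsProof
import HarnessLib

/-!
# Level descent (LD@N): the j-free m-indexed form, the reduction of `levelDescentW/V` to it, and the three-term and two-term induction steps in the (2,7)-plane — PROVED

HONEST FRAMING: systematic search; no irrationality claim unless certified.

OUR work (Summit side; planner gen-1 g7, 2026-08-20; memo `pub-zeta5-gen-1/D2-LD-PROOF-g7.md` §9 items S0 and S2).  Everything here is a proved identity /
implication between rational numbers; the two named PROOF TARGETS `ldBoxW`, `ldBoxV` (INTERNALLY MINTED, `@[conjecture]`) are the outputs the induction of memo §5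
must deliver on the box, in the j-free, m-indexed form

  `casUW b = Σ_{m=0}^{N} ldW(b;m) · W(N; N+1, 0, b₃, b₄, b₅, b₆, m)`   (resp. `casUV`, `V`),      `ldSum X b := Σ_{m ∈ Icc 0 N} ldW b m · X (degShape b (b₇ − m))`.

* S0 `levelDescentW_reduction_holds : ldBoxW → levelDescentW`, `levelDescentV_reduction_holds : ldBoxV → levelDescentV` — by the j-freeness of the wedge
  (`wedgeSlotFree_holds`) and the re-indexing `ldW_rhs_reindex` (T1's `i`-sum with `ldWeight` = the `m`-sum with the truncated symmetric weight `ldW`; reflection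
  `i = b₇ − m`, `ldWeight_eq_sym`, support cut by `ldSupp`).
* S2 `ldStep27_holds : ldStep27_stmt` — the THREE-TERM INDUCTION STEP in the (2,7)-plane: if a wedge functional `C` is cross-contiguous at `b` (`CrossRel C b`,
  e.g. from `crossContiguity_holds`) and `C = ldSum X` holds at `b` and at `b − e₇`, then it holds at `b − e₂`, provided `b₂Π₂(b) ≠ 0` — from `ldW_cross` summed over
  `m` (the shapes `degShape · (·₇ − m)` of `b`, `b − e₂`, `b − e₇` coincide: `degShape_lower2`, `degShape_lower7`).
* S3 `casUW_twoTerm` + `ldRowStep2_holds : ldRowStep2_stmt` — the TWO-TERM BRANCH on the rows `b₇ = 0` (ζ(3)-row): `(d+1)·casUW(b) = Π₂·casUW(b−e₂)`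
  (`quadM3_face_step` at `b − e₂`, direction 2, via `wedgeQ_eq_quadM3`) and the corresponding step for `C = ldSum X` from `ldW_twoTerm` (only `m = 0` survives).
What this is NOT: the induction itself (memo §9 S1, S4, S5) or the series-side face value; nothing about irrationality.
-/

open Finset

namespace Summit.KontsevichZagierPeriods.Zeta5Search.WedgeDictionary

open Summit.KontsevichZagierPeriods.Zeta5Search.DualSeries


/-- Off the support the truncated weight vanishes (definitional). -/
theorem ldW_of_not_supp (b : ℕ → ℤ) (m : ℤ) (h : ¬ ldSupp b m) : ldW b m = 0 := by
  simp [ldW, h]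

/-- On the support the truncated weight is the symmetric weight (definitional). -/
theorem ldW_of_supp (b : ℕ → ℤ) (m : ℤ) (h : ldSupp b m) : ldW b m = ldWeightSym b m := by
  simp [ldW, h]

/-- **Re-indexing PROVED.** For a balanced shape (`2 b_k ≤ N`, all slots) and any `K ≥ b₇`, the level-descent right-hand side in the index `i`
with the weight `ldWeight` equals the sum over `m ∈ Icc 0 K` of the truncated symmetric weight `ldW b m` against the same shapes
(`degShape b (b₇ − m)` has slot 7 equal to `m`). -/
theorem ldW_rhs_reindex (X : (ℕ → ℤ) → ℚ) (b : ℕ → ℤ) (hB : ∀ k ∈ Icc 1 7, 0 ≤ b k ∧ 2 * b k ≤ b 0) (K : ℤ) (hK : b 7 ≤ K) :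
    ∑ i ∈ Icc (max 0 (max (b 7 - b 1) (b 7 - b 2))) (min (b 0 - b 1 - b 2) (b 7)), ldWeight b i * X (degShape b i) =
      ∑ m ∈ Icc 0 K, ldW b m * X (degShape b (b 7 - m)) := by
  simp only [mem_Icc] at hB
  have h1 := hB 1 (by norm_num); have h2 := hB 2 (by norm_num); have h3 := hB 3 (by norm_num)
  have h4 := hB 4 (by norm_num); have h5 := hB 5 (by norm_num); have h6 := hB 6 (by norm_num)
  have h7 := hB 7 (by norm_num)
  -- reflect the index: i = b₇ − m
  have hA : ∑ i ∈ Icc (max 0 (max (b 7 - b 1) (b 7 - b 2))) (min (b 0 - b 1 - b 2) (b 7)), ldWeight b i * X (degShape b i) =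
      ∑ m ∈ Icc (b 7 - min (b 0 - b 1 - b 2) (b 7)) (b 7 - max 0 (max (b 7 - b 1) (b 7 - b 2))),
        ldWeightSym b m * X (degShape b (b 7 - m)) := by
    apply Finset.sum_nbij' (fun i => b 7 - i) (fun m => b 7 - m)
    · intro i hi; simp only [mem_Icc] at hi ⊢; omega
    · intro m hm; simp only [mem_Icc] at hm ⊢; omega
    · intro i _; ring
    · intro m _; ring
    · intro i _; rw [ldWeight_eq_sym, sub_sub_cancel]
  rw [hA]
  symm
  rw [← Finset.sum_subset (s₁ := Icc (b 7 - min (b 0 - b 1 - b 2) (b 7)) (b 7 - max 0 (max (b 7 - b 1) (b 7 - b 2))))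
      (s₂ := Icc 0 K)]
  · apply Finset.sum_congr rfl
    intro m hm
    simp only [mem_Icc] at hm
    rw [ldW_of_supp]
    refine ⟨?_, by omega, ?_, by omega, by omega, by omega⟩
    · intro t ht j hj
      simp only [Icc_three_six, mem_insert, mem_singleton] at ht hj
      rcases ht with rfl | rfl | rfl <;> rcases hj with rfl | rfl | rfl | rfl <;> omega
    · simp only [sigmaT]; omega
  · intro m hm
    simp only [mem_Icc] at hm ⊢
    omega
  · intro m _ hnot
    rw [ldW_of_not_supp, zero_mul]
    intro hS
    apply hnot
    obtain ⟨-, h0, hσ, hm1, hm2, hm7⟩ := hS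
    simp only [sigmaT] at hσ
    simp only [mem_Icc]
    omega


/-! ## The j-free m-indexed form -/

/-- `ldSum X b = Σ_{m ∈ Icc 0 N} ldW b m · X (degShape b (b₇ − m))` — the right-hand side of (LD@N) in the index `m` (slot 7 of the degenerate shape). -/
noncomputable def ldSum (X : (ℕ → ℤ) → ℚ) (b : ℕ → ℤ) : ℚ := ∑ m ∈ Icc 0 (b 0), ldW b m * X (degShape b (b 7 - m))

/-- The box hypotheses of `levelDescentW` (without the slot `j`). -/
def LDBoxHyp (b : ℕ → ℤ) : Prop :=
  InBox b ∧ (∀ k ∈ Icc 1 7, 2 * b k ≤ b 0) ∧ 0 ≤ dOf b ∧ b 0 - b 1 - b 2 ≤ dOf b + max 0 (max (b 7 - b 1) (b 7 - b 2))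

/-- PROOF TARGET (INTERNALLY MINTED; the output of the induction of memo §5/§9 on the box, ζ(3)-row): `casUW b = ldSum W b` under `LDBoxHyp b`. -/
@[conjecture] def ldBoxW : Prop := ∀ b : ℕ → ℤ, LDBoxHyp b → casUW b = ldSum coeffW b

/-- PROOF TARGET (INTERNALLY MINTED; constant row, clean cone `c₁₂ ≤ b₇`): `casUV b = ldSum V b` under `LDBoxHyp b ∧ c₁₂ ≤ b₇`. -/
@[conjecture] def ldBoxV : Prop := ∀ b : ℕ → ℤ, LDBoxHyp b → b 0 - b 1 - b 2 ≤ b 7 → casUV b = ldSum coeffV b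

/-- STATEMENT (S0, PROVED below): the m-indexed box identity implies `levelDescentW` as filed. -/
def levelDescentW_reduction : Prop := ldBoxW → levelDescentW

/-- STATEMENT (S0, PROVED below): the m-indexed box identity implies `levelDescentV` as filed. -/
def levelDescentV_reduction : Prop := ldBoxV → levelDescentV

/-- Slot bounds from the box hypotheses: `0 ≤ b_k`, `2b_k ≤ N` for `k = 1..7`. -/
theorem ldBox_bounds (b : ℕ → ℤ) (hbox : InBox b) (hB : ∀ k ∈ Icc 1 7, 2 * b k ≤ b 0) :
    ∀ k ∈ Icc 1 7, 0 ≤ b k ∧ 2 * b k ≤ b 0 := by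
  intro k hk
  have hk' := mem_Icc.1 hk
  have h := hbox.2 (k - 1) (by simp only [mem_range]; omega)
  have e : k - 1 + 1 = k := by omega
  rw [e] at h
  exact ⟨h.1, hB k hk⟩

/-- **S0 for the ζ(3)-row.** -/
theorem levelDescentW_reduction_holds : levelDescentW_reduction := by
  intro H b j hj hbox hB hd hcl
  have hb := ldBox_bounds b hbox hB
  have h7 := hb 7 (by simp)
  have hjb := hb j hj
  obtain ⟨hUW, -⟩ := wedgeSlotFree_holds b j hj hbox hd (by omega) (by omega)
  rw [hUW, ldW_rhs_reindex coeffW b hb (b 0) (by omega)]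
  exact H b ⟨hbox, hB, hd, hcl⟩

/-- **S0 for the constant row.** -/
theorem levelDescentV_reduction_holds : levelDescentV_reduction := by
  intro H b j hj hbox hB hd hcl1 hcl
  have hb := ldBox_bounds b hbox hB
  have h7 := hb 7 (by simp)
  have hjb := hb j hj
  obtain ⟨-, hUV⟩ := wedgeSlotFree_holds b j hj hbox hd (by omega) (by omega)
  rw [hUV, ldW_rhs_reindex coeffV b hb (b 0) (by omega)]
  exact H b ⟨hbox, hB, hd, hcl⟩ hcl1

/-! ## S2: the three-term step in the (2,7)-plane -/

/-- The degenerate shapes of `b − e₂` and of `b` coincide (`m`-indexed). -/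
theorem degShape_lower2 (b : ℕ → ℤ) (m : ℤ) : degShape (lowerSlot b 2) (lowerSlot b 2 7 - m) = degShape b (b 7 - m) := by
  funext s
  simp only [degShape, lowerSlot, Function.update_apply]
  by_cases h1 : s = 1
  · simp [h1]
  · by_cases h2 : s = 2
    · simp [h2]
    · by_cases h7 : s = 7
      · simp [h7]
      · simp [h1, h2, h7]

/-- The degenerate shapes of `b − e₇` and of `b` coincide (`m`-indexed). -/
theorem degShape_lower7 (b : ℕ → ℤ) (m : ℤ) : degShape (lowerSlot b 7) (lowerSlot b 7 7 - m) = degShape b (b 7 - m) := by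
  funext s
  simp only [degShape, lowerSlot, Function.update_apply]
  by_cases h1 : s = 1
  · simp [h1]
  · by_cases h2 : s = 2
    · simp [h2]
    · by_cases h7 : s = 7
      · simp [h7]
      · simp [h1, h2, h7]

/-- `(b − e₇)₀ = N`. -/
theorem lowerSlot7_zero (b : ℕ → ℤ) : lowerSlot b 7 0 = b 0 := by simp [lowerSlot]

/-- STATEMENT (S2, PROVED below as `ldStep27_holds`): the three-term induction step in the (2,7)-plane. -/
def ldStep27_stmt : Prop :=
  ∀ (X C : (ℕ → ℤ) → ℚ) (b : ℕ → ℤ), 0 ≤ b 0 → (∀ j ∈ Icc 1 7, 0 ≤ b j ∧ b j ≤ b 0) → (∀ j ∈ Icc 3 6, 2 * b j ≤ b 0) →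
    0 ≤ dOf b → 1 ≤ b 2 → 1 ≤ b 7 → (b 2 : ℚ) * mixedPi2 b ≠ 0 → CrossRel C b →
    C b = ldSum X b → C (lowerSlot b 7) = ldSum X (lowerSlot b 7) → C (lowerSlot b 2) = ldSum X (lowerSlot b 2)

/-- **S2 PROVED.** -/
theorem ldStep27_holds : ldStep27_stmt := by
  intro X C b hN hS hB hd h2 h7 hPi hC h1 h7'
  -- termwise weight relation, in the `mixedPi`/`lowerSlot` vocabulary
  have hw : ∀ m : ℤ, ((b 2 : ℚ) - b 7) * ((dOf b : ℚ) + 1) * ldW b m =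
      (b 2 : ℚ) * mixedPi2 b * ldW (lowerSlot b 2) m - (b 7 : ℚ) * mixedPi7 b * ldW (lowerSlot b 7) m :=
    fun m => ldW_cross b m hN hS hB hd h2 h7
  unfold ldSum at h1 h7' ⊢
  rw [lowerSlot2_zero]
  rw [lowerSlot7_zero] at h7'
  simp_rw [degShape_lower2] 
  simp_rw [degShape_lower7] at h7'
  unfold CrossRel at hC
  -- b₂Π₂ · (Σ ldW(b−e₂) X) = (b₂−b₇)(d+1) Σ ldW(b) X + b₇Π₇ Σ ldW(b−e₇) X
  have key : (b 2 : ℚ) * mixedPi2 b * ∑ m ∈ Icc 0 (b 0), ldW (lowerSlot b 2) m * X (degShape b (b 7 - m)) =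
      ((b 2 : ℚ) - b 7) * ((dOf b : ℚ) + 1) * ∑ m ∈ Icc 0 (b 0), ldW b m * X (degShape b (b 7 - m)) +
        (b 7 : ℚ) * mixedPi7 b * ∑ m ∈ Icc 0 (b 0), ldW (lowerSlot b 7) m * X (degShape b (b 7 - m)) := by
    rw [mul_sum, mul_sum, mul_sum, ← sum_add_distrib]
    apply sum_congr rfl
    intro m _
    have := hw m
    linear_combination (-(X (degShape b (b 7 - m)))) * this
  rw [← h1, ← h7'] at key
  have key2 : (b 2 : ℚ) * mixedPi2 b * ∑ m ∈ Icc 0 (b 0), ldW (lowerSlot b 2) m * X (degShape b (b 7 - m)) =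
      (b 2 : ℚ) * mixedPi2 b * C (lowerSlot b 2) := by
    linear_combination key + hC
  exact (mul_left_cancel₀ hPi key2).symm


/-! ## S3: the two-term branch on the rows `b₇ = 0` (ζ(3)-row only) -/

/-- `faceGamma0 (b − e₂) 1 = Π₂(b)`. -/
theorem faceGamma0_lowerSlot2 (b : ℕ → ℤ) : faceGamma0 (lowerSlot b 2) 1 = mixedPi2 b := by
  simp only [faceGamma0, mixedPi2, prod_range_succ, prod_range_zero, Nat.reduceAdd, lowerSlot2_apply]
  simp
  ring

/-- The `casUW` two-term relation on the rows `b₇ = 0`: `(d+1)·casUW(b) = Π₂(b)·casUW(b − e₂)` — `quadM3_face_step` at `b − e₂` in direction 2,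
read through `wedgeQ_eq_quadM3` (slot-7 wedge = `quadM3`). -/
theorem casUW_twoTerm (b : ℕ → ℤ) (hb : InBox b) (h7 : b 7 = 0) (hd : 0 ≤ dOf b) (h2 : 1 ≤ b 2) (h2N : b 2 ≤ b 0) :
    ((dOf b : ℚ) + 1) * casUW b = mixedPi2 b * casUW (lowerSlot b 2) := by
  obtain ⟨h0, h1, h2', h3, h4, h5, h6, h7'⟩ := (inBox_iff b).1 hb
  have ha : InBox (lowerSlot b 2) := by
    rw [inBox_iff]; simp only [lowerSlot2_apply]; simp; omega
  have ha7 : lowerSlot b 2 7 = 0 := by rw [lowerSlot2_seven]; exact h7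
  have hda : 1 ≤ dOf (lowerSlot b 2) := by rw [dOf_lowerSlot2]; omega
  have hbi : lowerSlot b 2 (1 + 1) + 1 ≤ lowerSlot b 2 0 := by
    simp only [Nat.reduceAdd, lowerSlot2_two, lowerSlot2_zero]; omega
  have step := quadM3_face_step (lowerSlot b 2) ha ha7 hda (i := 1) (by simp) hbi
  rw [dOf_lowerSlot2, faceGamma0_lowerSlot2] at step
  have e : bump (lowerSlot b 2) 1 = b := by simp only [bump, Nat.reduceAdd]; exact update2_lowerSlot2 b
  rw [e] at step
  have q1 := wedgeQ_eq_quadM3 b hb hd (i := 6) (by simp) (by simp only [Nat.reduceAdd]; omega)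
  have q2 := wedgeQ_eq_quadM3 (lowerSlot b 2) ha (by omega) (i := 6) (by simp)
    (by simp only [Nat.reduceAdd, lowerSlot2_seven, lowerSlot2_zero]; omega)
  simp only [Nat.reduceAdd] at q1 q2
  have e1 : Function.update b 7 (b 7 + 1) = bump b 6 := by simp only [bump, Nat.reduceAdd]
  have e2 : Function.update (lowerSlot b 2) 7 (lowerSlot b 2 7 + 1) = bump (lowerSlot b 2) 6 := by simp only [bump, Nat.reduceAdd]
  rw [e1] at q1
  rw [e2] at q2
  have c1 : casUW b = quadM3 b := by unfold casUW; exact q1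
  have c2 : casUW (lowerSlot b 2) = quadM3 (lowerSlot b 2) := by unfold casUW; exact q2
  rw [c1, c2]
  push_cast at step
  linear_combination step


/-- STATEMENT (PROVED below as `casUW_twoTerm_holds`): the `casUW` two-term relation on the rows `b₇ = 0`. -/
def casUW_twoTerm_stmt : Prop :=
  ∀ b : ℕ → ℤ, InBox b → b 7 = 0 → 0 ≤ dOf b → 1 ≤ b 2 → b 2 ≤ b 0 → ((dOf b : ℚ) + 1) * casUW b = mixedPi2 b * casUW (lowerSlot b 2)

/-- `casUW_twoTerm_stmt` holds. -/
theorem casUW_twoTerm_holds : casUW_twoTerm_stmt := fun b hb h7 hd h2 h2N => casUW_twoTerm b hb h7 hd h2 h2N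

/-- STATEMENT (S3, PROVED below as `ldRowStep2_holds`): the two-term induction step on the rows `b₇ = 0`, direction 2: a wedge functional `C` with the
two-term relation `(d+1)·C(b) = Π₂·C(b−e₂)` (e.g. `casUW`, `casUW_twoTerm`) and `C(b) = ldSum X b` satisfies `C(b−e₂) = ldSum X (b−e₂)`, provided `Π₂(b) ≠ 0`. -/
def ldRowStep2_stmt : Prop :=
  ∀ (X C : (ℕ → ℤ) → ℚ) (b : ℕ → ℤ), 0 ≤ b 0 → (∀ j ∈ Icc 1 7, 0 ≤ b j ∧ b j ≤ b 0) → (∀ j ∈ Icc 3 6, 2 * b j ≤ b 0) →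
    0 ≤ dOf b → 1 ≤ b 2 → b 7 = 0 → mixedPi2 b ≠ 0 →
    ((dOf b : ℚ) + 1) * C b = mixedPi2 b * C (lowerSlot b 2) →
    C b = ldSum X b → C (lowerSlot b 2) = ldSum X (lowerSlot b 2)

/-- **S3 PROVED.** -/
theorem ldRowStep2_holds : ldRowStep2_stmt := by
  intro X C b hN hS hB hd h2 h7 hPi hC h1
  have hw0 := ldW_twoTerm b hN hS hB hd h2 h7
  have hw : ∀ m ∈ Icc (0 : ℤ) (b 0), ((dOf b : ℚ) + 1) * (ldW b m * X (degShape b (b 7 - m))) =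
      mixedPi2 b * (ldW (lowerSlot b 2) m * X (degShape b (b 7 - m))) := by
    intro m _
    by_cases hm0 : m = 0
    · subst hm0
      unfold mixedPi2 lowerSlot
      linear_combination (X (degShape b (b 7 - 0))) * hw0
    · have z1 : ldW b m = 0 := ldW_of_not_supp b m (by
        intro hs; obtain ⟨-, hm, -, -, -, hm7⟩ := hs; omega)
      have z2 : ldW (lowerSlot b 2) m = 0 := ldW_of_not_supp _ m (by
        intro hs; obtain ⟨-, hm, -, -, -, hm7⟩ := hs; rw [lowerSlot2_seven] at hm7; omega)
      rw [z1, z2]; ring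
  unfold ldSum at h1 ⊢
  rw [lowerSlot2_zero]
  simp_rw [degShape_lower2]
  have key : ((dOf b : ℚ) + 1) * ∑ m ∈ Icc 0 (b 0), ldW b m * X (degShape b (b 7 - m)) =
      mixedPi2 b * ∑ m ∈ Icc 0 (b 0), ldW (lowerSlot b 2) m * X (degShape b (b 7 - m)) := by
    rw [mul_sum, mul_sum]; exact sum_congr rfl hw
  rw [← h1, hC] at key
  exact mul_left_cancel₀ hPi key

end Summit.KontsevichZagierPeriods.Zeta5Search.WedgeDictionary
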